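import Summits.QuantumFields.YangMills.Theorems.UnitScaleTiltProp7Lane2PatchCommutatorH1
import Literature.MathematicalPhysics.QuantumFieldTheory.Balaban1983to89.B4Eq19LatticeOperators
import HarnessLib

/-!
# Route `UnitScaleTilt`, crux «MinimiserStabilityRegPr» (stmt-QuantumFields-19200), E′ ∕ (N06) LANE II — brick (B6-LOC), FILE 3 of 3:
# THE KNIT-FACING END — CYCLIC CUBES SATISFY THE CLOSURE HYPOTHESIS, THE LOCAL GRADIENT ENERGY IS PAID BY THE CHART ENERGY, AND THE THREE BUDGET SLOTS BY `exact`

Cell `ym3-torus`, width seat `ym3-torus-px11` (gen 7).  THEOREMS ONLY (0 `def`, 0 `sorry`); `--supports stmt-QuantumFields-19200`, count-neutral.  YM₃ on T³ is a ladder rung (R3), not the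
Clay problem; nothing here claims (B7), (REC), `hN06`, a stub, the crux, d = 4 or the mass gap.

THE POINT.  FILES 1–2 (✓∕⧗`…PatchCommutatorRows`, `…PatchCommutatorH1`) state the per-patch rows `h5`∕`h6`∕`h11` for ANY finsets `S ⊆ S'` under (i) «`ζ` constant on the 2-cell about
every `x ∉ S`» (discharged by `cellConst_of_support` for `S ⊇` the cyclic cube of radius `D + 1`, `D = L^s·ℓ`) and (ii) the closure «`S'` ∋ `x, x ± e_μ, x + e_μ + e_ν` for `x ∈ S`».
Here: (ii) for the CYCLIC CUBES `S := {cycdist(·,c) < r coordinatewise}`, `S' := {… < r + 2}` (§1, one lattice step moves a cyclic coordinate distance by at most one —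
✓`Prop7Lane2CyclicHats.dist_add_one_le`), so the knit takes `r := D + 2` and both hypotheses cost one line each; and (§2) the reading of FILE 1's local gradient energy
`G_{S'} = c₀Σ_{y∈S'}Σ_μ‖Y⟨y,μ⟩‖_F²` through an injective chart `τ` on a finset `B` of `ℤᵈ`-points whose inside bonds carry `Y⟨τ w, μ⟩ = g w μ` ((B8-member)'s (D) with `τ := transl basePt`,
`B := box (w₀+z) R_f`): `G_{S'} ≤ c₀Σ_{w∈B}Σ_μ 𝟙[w + e_μ ∈ B]‖g w μ‖_F²` = the `Gφ_c` letter of ✓`Prop7DivRecoveryCutoffReadings.patch_h1` (so `G_{S'} ≤ Gφ_c ≤ N_c`), whenever every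
`y ∈ S'`, `μ` has `y = τ w` with `w, w + e_μ ∈ B` (px9 ✓`Prop7Lane2SupportInChart.exists_mem_box_transl_eq_bond_recentre`).
§3 (px16 g8's read note): the three budget slots BY `exact` — `norm_sq_gradComm_le_of_le` (`h6`, `CM = 27∕4`, any `Φt ≥ Φ_S`), `norm_sq_lapComm_le_of_le` (`h5`, `Cζ = 972`, any `N ≥ G_{S'}`,
`Φ ≥ Φ_S`), `localEnergy_gradComm_le_of_le` (`h11`, `CH = 4536`, any `Gφ ≥ G_{S'}`, `Φ ≥ Φ_{S'}`, window `e·R² ≤ 1`).  §4: the SUPPORTS of the two commutators in cube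
letters (`lapComm_support`, `gradComm_support`: radius `D + 2`; `gradComm_collar_support`: the 1-collar at radius `D + 3`) — the `hν`∕`hsupp` inputs of ✓`Prop7Lane2OverlapRows`' three family rows.
HONEST SCOPE.  Finite-set bookkeeping; nothing of `hPatch`∕(B7)∕(REC)∕hN06∕the crux is proved or claimed.

References: T. Bałaban, CMP 99 (1985) 389–434 [Balaban1985BackgroundPropagators] ((3.19) p.393, (3.100) pp.413–414); [folklore].
-/

set_option autoImplicit false

noncomputable section

open scoped BigOperators Matrix.Norms.L2Operator Matrix

namespace Summit.QuantumFields.YangMills.Theorems.Prop7Lane2PatchCommutatorCubes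

open Literature.MathematicalPhysics.QuantumFieldTheory.Balaban1983to89
open Literature.MathematicalPhysics.QuantumFieldTheory.Balaban1983to89.T3ContinuumYM3Torus
open Literature.MathematicalPhysics.QuantumFieldTheory.Balaban1983to89.B4Eq19LatticeOperators (Zd unitVec)
open Summit.QuantumFields.YangMills.Theorems.Prop7Lane2CyclicHats (dist_add_one_le dist_sub_one_le)
open Finset

variable (F : T3Family) (K : ℕ)

/-! ## §1 Cyclic cubes about the centre: one step, and the closure hypothesis of FILES 1–2 -/

/-- ★ **ONE STEP**: if every coordinate of `x` is within cyclic distance `< r` of `c`, then every coordinate of `x ± e_μ` is within `< r + 1`. [folklore] -/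
theorem cycCube_step (c x : Site (F.P K) 0) {r : ℕ} (hx : ∀ κ : Fin 3, min (x κ - c κ).val (c κ - x κ).val < r) (μ : Fin 3) :
    (∀ κ : Fin 3, min ((x.shift μ) κ - c κ).val (c κ - (x.shift μ) κ).val < r + 1) ∧
      (∀ κ : Fin 3, min ((x.unshift μ) κ - c κ).val (c κ - (x.unshift μ) κ).val < r + 1) := by
  -- `1 < N₀` (inlined; = ✓`LocalInsertionExpMomentSU2TorusT3.one_lt_sitesPerDir`, a foreign lane's module not imported here)
  have hN : 1 < (F.P K).sitesPerDir 0 := by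
    show 1 < 2 * F.L ^ (F.m + K - 0)
    have := Nat.one_le_pow (F.m + K - 0) F.L (by have := F.hL.2; omega)
    omega
  constructor
  · intro κ
    by_cases h : κ = μ
    · subst h
      have e1 : (x.shift κ) κ = x κ + 1 := by simp [Site.shift]
      rw [e1]
      have := (dist_add_one_le hN (x κ) (c κ)).1
      have := hx κ
      omega
    · have e1 : (x.shift μ) κ = x κ := Function.update_of_ne h _ _
      rw [e1]
      have := hx κ
      omega
  · intro κ
    by_cases h : κ = μ
    · subst h
      have e1 : (x.unshift κ) κ = x κ - 1 := by simp [Site.unshift]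
      rw [e1]
      have := (dist_sub_one_le hN (x κ) (c κ)).1
      have := hx κ
      omega
    · have e1 : (x.unshift μ) κ = x κ := Function.update_of_ne h _ _
      rw [e1]
      have := hx κ
      omega

/-- ★★ **THE CLOSURE HYPOTHESIS FOR CYCLIC CUBES**: if `S` lies in the cyclic cube of radius `r − 1` about `c` (`cycdist < r` coordinatewise) and `S'` contains the cube of radius
`r + 1` (`cycdist < r + 2`), then `S'` contains `x`, `x ± e_μ` and `x + e_μ + e_ν` for every `x ∈ S` — the `hSS'` of FILES 1–2. [folklore] -/
theorem cycCube_closure (c : Site (F.P K) 0) (r : ℕ) (S S' : Finset (Site (F.P K) 0))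
    (hS : ∀ x ∈ S, ∀ κ : Fin 3, min (x κ - c κ).val (c κ - x κ).val < r)
    (hS' : ∀ x : Site (F.P K) 0, (∀ κ : Fin 3, min (x κ - c κ).val (c κ - x κ).val < r + 2) → x ∈ S') :
    ∀ x ∈ S, x ∈ S' ∧ ∀ μ : Fin 3, x.shift μ ∈ S' ∧ x.unshift μ ∈ S' ∧ ∀ ν : Fin 3, (x.shift μ).shift ν ∈ S' := by
  intro x hx
  have h0 := hS x hx
  refine ⟨hS' x fun κ => by have := h0 κ; omega, fun μ => ⟨?_, ?_, fun ν => ?_⟩⟩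
  · exact hS' _ fun κ => by have := (cycCube_step F K c x h0 μ).1 κ; omega
  · exact hS' _ fun κ => by have := (cycCube_step F K c x h0 μ).2 κ; omega
  · exact hS' _ fun κ => (cycCube_step F K c (x.shift μ) (cycCube_step F K c x h0 μ).1 ν).1 κ

/-- The localisation hypothesis `hS` of ✓`…PatchCommutatorH1.cellConst_of_support` for the cube `S := {cycdist < D + 2}` given as a filter, recorded for the knit. [folklore] -/
theorem mem_cycCube_filter (c : Site (F.P K) 0) (r : ℕ) (x : Site (F.P K) 0) :
    x ∈ (Finset.univ.filter fun y : Site (F.P K) 0 => ∀ κ : Fin 3, min (y κ - c κ).val (c κ - y κ).val < r)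
      ↔ ∀ κ : Fin 3, min (x κ - c κ).val (c κ - x κ).val < r := by
  simp only [Finset.mem_filter, Finset.mem_univ, true_and]

/-! ## §2 The local gradient energy read through an injective chart: `G_{S'} ≤ Gφ_c` -/

variable (c₀ : ℝ) [Fact (0 < c₀)]

/-- ★★ **`G_{S'} ≤ Gφ_c`**: for a bond functional `Y` on the torus, a finset `B ⊆ ℤᵈ` mapped injectively by `τ` into the torus, a chart-side `g` with `Y⟨τ w, μ⟩ = g w μ` on the
INSIDE bonds of `B` ((B8-member)'s (D)), and a finset `S'` of sites each of whose bonds `⟨y, μ⟩` is an inside bond of `B` (`y = τ w`, `w, w + e_μ ∈ B`):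
`c₀Σ_{y∈S'}Σ_μ‖Y⟨y,μ⟩‖_F² ≤ c₀Σ_{w∈B}Σ_μ 𝟙[w + e_μ ∈ B]‖g w μ‖_F²` — FILE 1's `G_{S'}` is paid by the `Gφ_c` letter of ✓`Prop7DivRecoveryCutoffReadings.patch_h1`.
[cite: Balaban1985BackgroundPropagators, (3.19) p.393] -/
theorem localGrad_le_chartEnergy (Y : PBond (F.P K) 0 → Matrix (Fin 2) (Fin 2) ℂ) (B : Finset (Zd (F.P K).d)) (τ : Zd (F.P K).d → Site (F.P K) 0)
    (hinj : Set.InjOn τ ↑B) (g : Zd (F.P K).d → Fin (F.P K).d → Matrix (Fin 2) (Fin 2) ℂ)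
    (hD : ∀ w ∈ B, ∀ μ, w + unitVec μ ∈ B → Y ⟨τ w, μ⟩ = g w μ)
    (S' : Finset (Site (F.P K) 0)) (hS' : ∀ y ∈ S', ∀ μ : Fin (F.P K).d, ∃ w ∈ B, τ w = y ∧ w + unitVec μ ∈ B) :
    c₀ * ∑ y ∈ S', ∑ μ : Fin (F.P K).d, ∑ j : Fin 2, ∑ k : Fin 2, ‖(Y ⟨y, μ⟩) j k‖ ^ 2
      ≤ c₀ * ∑ w ∈ B, ∑ μ : Fin (F.P K).d, (if w + unitVec μ ∈ B then ∑ j : Fin 2, ∑ k : Fin 2, ‖(g w μ) j k‖ ^ 2 else 0) := by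
  classical
  have hc : (0 : ℝ) < c₀ := Fact.out
  refine mul_le_mul_of_nonneg_left ?_ hc.le
  rw [Finset.sum_comm, Finset.sum_comm (s := B)]
  refine Finset.sum_le_sum fun μ _ => ?_
  -- per direction: `S' ⊆ τ(B_μ)` with `B_μ := {w ∈ B | w + e_μ ∈ B}`, and on `τ(B_μ)` the summand is `hs(g w μ)`
  have hsub : S' ⊆ (B.filter fun w => w + unitVec μ ∈ B).image τ := by
    intro y hy
    obtain ⟨w, hw, hwy, hwμ⟩ := hS' y hy μ
    exact Finset.mem_image.mpr ⟨w, Finset.mem_filter.mpr ⟨hw, hwμ⟩, hwy⟩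
  have hinj' : Set.InjOn τ ↑(B.filter fun w => w + unitVec μ ∈ B) := fun w₁ h₁ w₂ h₂ h =>
    hinj (Finset.mem_filter.mp h₁).1 (Finset.mem_filter.mp h₂).1 h
  calc ∑ y ∈ S', ∑ j : Fin 2, ∑ k : Fin 2, ‖(Y ⟨y, μ⟩) j k‖ ^ 2
      ≤ ∑ y ∈ (B.filter fun w => w + unitVec μ ∈ B).image τ, ∑ j : Fin 2, ∑ k : Fin 2, ‖(Y ⟨y, μ⟩) j k‖ ^ 2 :=
        Finset.sum_le_sum_of_subset_of_nonneg hsub fun y _ _ => Finset.sum_nonneg fun _ _ => Finset.sum_nonneg fun _ _ => sq_nonneg _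
    _ = ∑ w ∈ B.filter (fun w => w + unitVec μ ∈ B), ∑ j : Fin 2, ∑ k : Fin 2, ‖(Y ⟨τ w, μ⟩) j k‖ ^ 2 := Finset.sum_image hinj'
    _ = ∑ w ∈ B, (if w + unitVec μ ∈ B then ∑ j : Fin 2, ∑ k : Fin 2, ‖(g w μ) j k‖ ^ 2 else 0) := by
        rw [Finset.sum_filter]
        refine Finset.sum_congr rfl fun w hw => ?_
        split_ifs with h
        · rw [hD w hw μ h]
        · rfl

/-! ## §3 The budget's three slots BY `exact`: monotonicity in the local letters (px16 g8's 11:42:49Z note) -/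

section Slots

open Literature.MathematicalPhysics.QuantumFieldTheory.Balaban1983to89.T3PrintedRegularMinimiser (RegPr)
open B10Eq27TorusAxialLog (unitsField toUField)
open B9Eq39Adjoint (curl)
open B9TorusCalculus (torusT)
open B11Eq103H1Complex (SiteL2K BondL2K)
open Summit.QuantumFields.YangMills.Theorems.Prop7SectET3Transport (periodsT3)
open Summit.QuantumFields.YangMills.Theorems.Prop7SectET3HilbertLetters (W₂ toL2 toL2S DL2 DstarL2 covLapSite)
open Summit.QuantumFields.YangMills.Theorems.Prop7Lane2PatchCommutatorRows (norm_sq_gradComm_le_member norm_sq_lapComm_le_slot)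
open Summit.QuantumFields.YangMills.Theorems.Prop7Lane2PatchCommutatorH1 (localEnergy_gradComm_le_slot)

variable (n : ℕ) {e : ℝ} (W : GaugeField (F.P K) 0 (Matrix.specialUnitaryGroup (Fin 2) ℂ))
  (Z : SiteL2K ℂ 3 (periodsT3 F K) c₀ W₂ →ₗ[ℂ] SiteL2K ℂ 3 (periodsT3 F K) c₀ W₂)
  (ZE : BondL2K ℂ 3 (periodsT3 F K) c₀ W₂ →ₗ[ℂ] BondL2K ℂ 3 (periodsT3 F K) c₀ W₂) (ζ : Site (F.P K) 0 → ℝ) (s : ℕ)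

/-- ★★ **`h6` BY `exact`**: `M_c := ‖D_W(Z φ) − ZE(D_W φ)‖² ≤ (27∕4)·R⁻²·Φt` for any `Φt ≥` the local mass `Φ_S` (e.g. (a′)'s box mass via px9's `sum_le_boxSum_of_chart`) —
✓`patch_budget_v2`'s `h6` with `CM = 27∕4`. [cite: Balaban1985BackgroundPropagators, (3.3) p.391, (3.100) pp.413–414] -/
theorem norm_sq_gradComm_le_of_le
    (hZ : ∀ φ x, (toL2S F K c₀).symm (Z φ) x = ζ x • (toL2S F K c₀).symm φ x) (hZE : ∀ f b, (toL2 F K c₀).symm (ZE f) b = ζ b.src • (toL2 F K c₀).symm f b)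
    (S : Finset (Site (F.P K) 0))
    (hζ1 : ∀ (x : Site (F.P K) 0) (μ : Fin 3), |ζ (x.shift μ) - ζ x| ≤ 3 / 2 / ((F.L : ℝ) ^ s * (F.L : ℝ) ^ (K - n)) ∧
      |ζ (x.unshift μ) - ζ x| ≤ 3 / 2 / ((F.L : ℝ) ^ s * (F.L : ℝ) ^ (K - n)))
    (hζS : ∀ x : Site (F.P K) 0, x ∉ S → ∀ μ : Fin 3, ζ (x.shift μ) = ζ x ∧ ζ (x.unshift μ) = ζ x ∧ ∀ ν : Fin 3, ζ ((x.shift μ).shift ν) = ζ (x.shift μ))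
    (φ : SiteL2K ℂ 3 (periodsT3 F K) c₀ W₂) {Φt : ℝ} (hΦt : c₀ * ∑ x ∈ S, ∑ j : Fin 2, ∑ k : Fin 2, ‖((toL2S F K c₀).symm φ x) j k‖ ^ 2 ≤ Φt) :
    ‖DL2 F n K c₀ W (Z φ) - ZE (DL2 F n K c₀ W φ)‖ ^ 2 ≤ 27 / 4 * ((F.L : ℝ) ^ s)⁻¹ ^ 2 * Φt :=
  (norm_sq_gradComm_le_member F n K c₀ W Z ZE ζ s hZ hZE S hζ1 hζS φ).trans (mul_le_mul_of_nonneg_left hΦt (by positivity))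

/-- ★★ **`h5` BY `exact`**: `L_c := ‖Δ_W(Z φ) − Z(Δ_W φ)‖² ≤ 972·(R⁻²·N + R⁻⁴·Φ)` for any `N ≥ G_{S'}` (e.g. `Gφ_c ≤ N_c` via `localGrad_le_chartEnergy` + (h1)) and `Φ ≥ Φ_S`
(e.g. `‖φ_c‖²`) — ✓`patch_budget_v2`'s `h5` with `Cζ = 972`. [cite: Balaban1985BackgroundPropagators, (3.23) p.394, (3.100) pp.413–414] -/
theorem norm_sq_lapComm_le_of_le
    (hZ : ∀ φ x, (toL2S F K c₀).symm (Z φ) x = ζ x • (toL2S F K c₀).symm φ x) (S S' : Finset (Site (F.P K) 0))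
    (hζ1 : ∀ (x : Site (F.P K) 0) (μ : Fin 3), |ζ (x.shift μ) - ζ x| ≤ 3 / 2 / ((F.L : ℝ) ^ s * (F.L : ℝ) ^ (K - n)) ∧
      |ζ (x.unshift μ) - ζ x| ≤ 3 / 2 / ((F.L : ℝ) ^ s * (F.L : ℝ) ^ (K - n)))
    (hζ2 : ∀ (x : Site (F.P K) 0) (μ : Fin 3), |ζ (x.shift μ) + ζ (x.unshift μ) - 2 * ζ x| ≤ 6 / ((F.L : ℝ) ^ s * (F.L : ℝ) ^ (K - n)) ^ 2)
    (hζS : ∀ x : Site (F.P K) 0, x ∉ S → ∀ μ : Fin 3, ζ (x.shift μ) = ζ x ∧ ζ (x.unshift μ) = ζ x ∧ ∀ ν : Fin 3, ζ ((x.shift μ).shift ν) = ζ (x.shift μ))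
    (hSS' : ∀ x ∈ S, x ∈ S' ∧ ∀ μ : Fin 3, x.shift μ ∈ S' ∧ x.unshift μ ∈ S' ∧ ∀ ν : Fin 3, (x.shift μ).shift ν ∈ S')
    (φ : SiteL2K ℂ 3 (periodsT3 F K) c₀ W₂) {N Φ : ℝ}
    (hN : c₀ * ∑ y ∈ S', ∑ μ : Fin (F.P K).d, ∑ j : Fin 2, ∑ k : Fin 2, ‖((toL2 F K c₀).symm (DL2 F n K c₀ W φ) ⟨y, μ⟩) j k‖ ^ 2 ≤ N)
    (hΦ : c₀ * ∑ x ∈ S, ∑ j : Fin 2, ∑ k : Fin 2, ‖((toL2S F K c₀).symm φ x) j k‖ ^ 2 ≤ Φ) :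
    ‖covLapSite F n K c₀ W (Z φ) - Z (covLapSite F n K c₀ W φ)‖ ^ 2 ≤ 972 * (((F.L : ℝ) ^ s)⁻¹ ^ 2 * N + ((F.L : ℝ) ^ s)⁻¹ ^ 4 * Φ) := by
  refine (norm_sq_lapComm_le_slot F n K c₀ W Z ζ s hZ S S' hζ1 hζ2 hζS hSS' φ).trans (mul_le_mul_of_nonneg_left (add_le_add ?_ ?_) (by norm_num))
  · exact mul_le_mul_of_nonneg_left hN (by positivity)
  · exact mul_le_mul_of_nonneg_left hΦ (by positivity)

/-- ★★★ **`h11` BY `exact`**: on `RegPr F n K e W` with the knit's window `e·(L^s)² ≤ 1`, `H(D_W(Z φ) − ZE(D_W φ)) ≤ 4536·(R⁻²·Gφ + R⁻⁴·Φ)` for any `Gφ ≥ G_{S'}`, `Φ ≥ Φ_{S'}` —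
✓`patch_budget_v2`'s `h11` with `CH = 4536`. [cite: Balaban1985BackgroundPropagators, (3.4) p.391, (3.100) pp.413–414; Balaban1985Variational, (2) p.278] -/
theorem localEnergy_gradComm_le_of_le (he : 0 < e) (hW : RegPr F n K e W) (hew : e * ((F.L : ℝ) ^ s) ^ 2 ≤ 1)
    (hZ : ∀ φ x, (toL2S F K c₀).symm (Z φ) x = ζ x • (toL2S F K c₀).symm φ x) (hZE : ∀ f b, (toL2 F K c₀).symm (ZE f) b = ζ b.src • (toL2 F K c₀).symm f b)
    (S S' : Finset (Site (F.P K) 0))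
    (hζ1 : ∀ (x : Site (F.P K) 0) (μ : Fin 3), |ζ (x.shift μ) - ζ x| ≤ 3 / 2 / ((F.L : ℝ) ^ s * (F.L : ℝ) ^ (K - n)) ∧
      |ζ (x.unshift μ) - ζ x| ≤ 3 / 2 / ((F.L : ℝ) ^ s * (F.L : ℝ) ^ (K - n)))
    (hζ2 : ∀ (x : Site (F.P K) 0) (μ : Fin 3), |ζ (x.shift μ) + ζ (x.unshift μ) - 2 * ζ x| ≤ 6 / ((F.L : ℝ) ^ s * (F.L : ℝ) ^ (K - n)) ^ 2)
    (hζS : ∀ x : Site (F.P K) 0, x ∉ S → ∀ μ : Fin 3, ζ (x.shift μ) = ζ x ∧ ζ (x.unshift μ) = ζ x ∧ ∀ ν : Fin 3, ζ ((x.shift μ).shift ν) = ζ (x.shift μ))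
    (hSS' : ∀ x ∈ S, x ∈ S' ∧ ∀ μ : Fin 3, x.shift μ ∈ S' ∧ x.unshift μ ∈ S' ∧ ∀ ν : Fin 3, (x.shift μ).shift ν ∈ S')
    (φ : SiteL2K ℂ 3 (periodsT3 F K) c₀ W₂) {Gφ Φ : ℝ}
    (hG : c₀ * ∑ y ∈ S', ∑ μ : Fin (F.P K).d, ∑ j : Fin 2, ∑ k : Fin 2, ‖((toL2 F K c₀).symm (DL2 F n K c₀ W φ) ⟨y, μ⟩) j k‖ ^ 2 ≤ Gφ)
    (hΦ : c₀ * ∑ y ∈ S', ∑ j : Fin 2, ∑ k : Fin 2, ‖((toL2S F K c₀).symm φ y) j k‖ ^ 2 ≤ Φ) :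
    c₀ * ((F.L : ℝ) ^ (K - n)) ^ 2 * (∑ x : Site (F.P K) 0, ∑ μ : Fin (F.P K).d, ∑ ν' : Fin (F.P K).d,
        (if μ < ν' then ∑ j : Fin 2, ∑ k : Fin 2,
          ‖(curl (torusT (F.P K) 0) (fun κ z => unitsField (toUField W) ⟨z, κ⟩)
            (fun κ z => (toL2 F K c₀).symm (DL2 F n K c₀ W (Z φ) - ZE (DL2 F n K c₀ W φ)) ⟨z, κ⟩) μ ν' x) j k‖ ^ 2 else 0))
      + ‖DstarL2 F n K c₀ W (DL2 F n K c₀ W (Z φ) - ZE (DL2 F n K c₀ W φ))‖ ^ 2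
    ≤ 4536 * (((F.L : ℝ) ^ s)⁻¹ ^ 2 * Gφ + ((F.L : ℝ) ^ s)⁻¹ ^ 4 * Φ) := by
  refine (localEnergy_gradComm_le_slot F n K c₀ W Z ZE ζ s he hW hew hZ hZE S S' hζ1 hζ2 hζS hSS' φ).trans
    (mul_le_mul_of_nonneg_left (add_le_add ?_ ?_) (by norm_num))
  · exact mul_le_mul_of_nonneg_left hG (by positivity)
  · exact mul_le_mul_of_nonneg_left hΦ (by positivity)

end Slots

/-! ## §4 Supports of the two commutators in cube letters (the `hν`∕`hsupp` inputs of ✓`Prop7Lane2OverlapRows`' family rows) -/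

section Supports

open B11Eq103H1Complex (SiteL2K BondL2K)
open Summit.QuantumFields.YangMills.Theorems.Prop7SectET3Transport (periodsT3)
open Summit.QuantumFields.YangMills.Theorems.Prop7SectET3HilbertLetters (W₂ toL2 toL2S DL2 covLapSite)
open Summit.QuantumFields.YangMills.Theorems.Prop7Lane2PatchCommutatorRows (gradComm_apply_eq_zero lapComm_apply_eq_zero)
open Summit.QuantumFields.YangMills.Theorems.Prop7Lane2PatchCommutatorH1 (cellConst_of_support)

variable (n : ℕ) (W : GaugeField (F.P K) 0 (Matrix.specialUnitaryGroup (Fin 2) ℂ))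
  (Z : SiteL2K ℂ 3 (periodsT3 F K) c₀ W₂ →ₗ[ℂ] SiteL2K ℂ 3 (periodsT3 F K) c₀ W₂)
  (ZE : BondL2K ℂ 3 (periodsT3 F K) c₀ W₂ →ₗ[ℂ] BondL2K ℂ 3 (periodsT3 F K) c₀ W₂) (ζ : Site (F.P K) 0 → ℝ)

/-- ★ **SUPPORT OF THE LAPLACIAN COMMUTATOR**: with the package's support row for `ζ` about `c` at radius `D`, `toL2S⁻¹(Δ_W(Z φ) − Z(Δ_W φ))(x) ≠ 0` forces every coordinate of `x`
within cyclic distance `< D + 2` of `c` — the `hν` input of ✓`norm_sq_sum_le_of_overlap_site` for the `L`-family. [cite: Balaban1985BackgroundPropagators, (3.100) pp.413–414] -/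
theorem lapComm_support (hZ : ∀ φ x, (toL2S F K c₀).symm (Z φ) x = ζ x • (toL2S F K c₀).symm φ x) (c : Site (F.P K) 0) {D : ℕ}
    (hsupp : ∀ x : Site (F.P K) 0, ζ x ≠ 0 → ∀ κ : Fin 3, min (x κ - c κ).val (c κ - x κ).val < D)
    (φ : SiteL2K ℂ 3 (periodsT3 F K) c₀ W₂) (x : Site (F.P K) 0) (hx : (toL2S F K c₀).symm (covLapSite F n K c₀ W (Z φ) - Z (covLapSite F n K c₀ W φ)) x ≠ 0) :
    ∀ κ : Fin 3, min (x κ - c κ).val (c κ - x κ).val < D + 2 := by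
  classical
  by_contra h
  have hcell := cellConst_of_support F K ζ c hsupp (Finset.univ.filter fun y : Site (F.P K) 0 => ∀ κ : Fin 3, min (y κ - c κ).val (c κ - y κ).val < D + 2)
    (fun y hy => (mem_cycCube_filter F K c (D + 2) y).mpr hy) x (fun hx' => h ((mem_cycCube_filter F K c (D + 2) x).mp hx'))
  exact hx (lapComm_apply_eq_zero F n K c₀ Z ζ hZ W φ x fun μ => ⟨(hcell μ).1, (hcell μ).2.1⟩)

/-- ★ **SUPPORT OF THE GRADIENT COMMUTATOR**: `toL2⁻¹(D_W(Z φ) − ZE(D_W φ))(b) ≠ 0` forces every coordinate of `b.src` within cyclic distance `< D + 2` of `c` — the `hν` input of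
✓`norm_sq_sum_le_of_overlap_bond` for the `M`-family. [cite: Balaban1985BackgroundPropagators, (3.3) p.391, (3.100) pp.413–414] -/
theorem gradComm_support (hZ : ∀ φ x, (toL2S F K c₀).symm (Z φ) x = ζ x • (toL2S F K c₀).symm φ x)
    (hZE : ∀ f b, (toL2 F K c₀).symm (ZE f) b = ζ b.src • (toL2 F K c₀).symm f b) (c : Site (F.P K) 0) {D : ℕ}
    (hsupp : ∀ x : Site (F.P K) 0, ζ x ≠ 0 → ∀ κ : Fin 3, min (x κ - c κ).val (c κ - x κ).val < D)
    (φ : SiteL2K ℂ 3 (periodsT3 F K) c₀ W₂) (b : PBond (F.P K) 0) (hb : (toL2 F K c₀).symm (DL2 F n K c₀ W (Z φ) - ZE (DL2 F n K c₀ W φ)) b ≠ 0) :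
    ∀ κ : Fin 3, min (b.src κ - c κ).val (c κ - b.src κ).val < D + 2 := by
  classical
  by_contra h
  have hcell := cellConst_of_support F K ζ c hsupp (Finset.univ.filter fun y : Site (F.P K) 0 => ∀ κ : Fin 3, min (y κ - c κ).val (c κ - y κ).val < D + 2)
    (fun y hy => (mem_cycCube_filter F K c (D + 2) y).mpr hy) b.src (fun hx' => h ((mem_cycCube_filter F K c (D + 2) b.src).mp hx'))
  exact hb (gradComm_apply_eq_zero F n K c₀ Z ZE ζ hZ hZE W φ b (hcell b.dir).1)

/-- ★ **THE 1-COLLARED SUPPORT OF THE GRADIENT COMMUTATOR** (the `hsupp` input of ✓`localEnergy_sum_le_of_overlap` for the `HM`-family, `Ω_c :=` the cube of radius `D + 2`):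
`toL2⁻¹(u)(b) ≠ 0` forces `b.src`, `b.src ± e_μ` into `{cycdist(·, c) < D + 3}`. [cite: Balaban1985BackgroundPropagators, (3.100) pp.413–414] -/
theorem gradComm_collar_support (hZ : ∀ φ x, (toL2S F K c₀).symm (Z φ) x = ζ x • (toL2S F K c₀).symm φ x)
    (hZE : ∀ f b, (toL2 F K c₀).symm (ZE f) b = ζ b.src • (toL2 F K c₀).symm f b) (c : Site (F.P K) 0) {D : ℕ}
    (hsupp : ∀ x : Site (F.P K) 0, ζ x ≠ 0 → ∀ κ : Fin 3, min (x κ - c κ).val (c κ - x κ).val < D)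
    (φ : SiteL2K ℂ 3 (periodsT3 F K) c₀ W₂) (b : PBond (F.P K) 0) (hb : (toL2 F K c₀).symm (DL2 F n K c₀ W (Z φ) - ZE (DL2 F n K c₀ W φ)) b ≠ 0) :
    (∀ κ : Fin 3, min (b.src κ - c κ).val (c κ - b.src κ).val < D + 3) ∧
      ∀ μ : Fin 3, (∀ κ : Fin 3, min ((b.src.shift μ) κ - c κ).val (c κ - (b.src.shift μ) κ).val < D + 3) ∧
        (∀ κ : Fin 3, min ((b.src.unshift μ) κ - c κ).val (c κ - (b.src.unshift μ) κ).val < D + 3) := by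
  have h2 := gradComm_support F K c₀ n W Z ZE ζ hZ hZE c hsupp φ b hb
  exact ⟨fun κ => by have := h2 κ; omega, fun μ => cycCube_step F K c b.src h2 μ⟩

end Supports

end Summit.QuantumFields.YangMills.Theorems.Prop7Lane2PatchCommutatorCubes

end
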